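import Summits.BirchSwinnertonDyer.BirchSwinnertonDyer.Theses.PAdicOrderV2
import Summits.BirchSwinnertonDyer.BirchSwinnertonDyer.Theorems.PAdicOrderV2PAdicOrderThesisR2StubUBRank0
import Literature.NumberTheory.EllipticCurves.BSDAnalyticRankTunnellCMProofs
import Literature.NumberTheory.EllipticCurves.CongruentNumberCurveSupersingular
import Literature.NumberTheory.EllipticCurves.OrdinaryPrimesProofs
import Literature.Barriers.BirchSwinnertonDyer.PAdicFunctionalEquationParityProofs
import Literature.NumberTheory.EllipticCurves.KatoRankBound
import Literature.NumberTheory.EllipticCurves.SelmerCorankHolds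

/-!
# Disproof of `PAdicOrderPadicBSDrankR2` (stmt-BirchSwinnertonDyer-0490) — findings

Crux (routes `PAdicOrderV2` #3 / `PAdicOrder` #3): for every elliptic `E/ℚ` (globally minimal `W`),
EVERY prime `p` of good ordinary reduction (`p = 2, 3` included) and the newform `f` of `E`:
`ord_{T=0} L_p(f, unitRoot W p, T) = rank_ℤ E(ℚ)` — Mazur–Tate–Teitelbaum's BSD(`p`), rank clause.

VERDICT OF THIS CYCLE: **no kill; the statement as typed resists every in-tree attack**, for two
structural reasons recorded as theorems below, and is consistent with everything computable.

Findings (all `sorry`-free unless marked NEAR-MISS):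

* §1 JUNK VALUES (unconditional): `L_p(f, 0, T) = 0` (`padicLFunction_zero_root`) and
  `L_p(0, α, T) = 0` (`padicLFunction_zero_form`); off the ordinary locus the tree's `unitRoot` IS
  the junk `0` (`unitRoot_eq_zero_of_dvd_frobeniusTrace`). Hence the `ℕ∞`-valued conclusion
  `order = ↑rank` is violated exactly where a junk `0` enters.
* §2 LOAD-BEARING HYPOTHESES ("any proof must use H"):
  - `IsNewformOf W f` is load-bearing: `crux_false_without_newform : ¬ WithoutNewform`
    (UNCONDITIONAL; witness `W = E₁ : y² = x³ - x`, any good ordinary `p`, `f = 0`).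
  - ordinarity `p ∤ a_p` is load-bearing: `crux_false_without_ordinary_of_isNewformOf`
    (witness `E₁`, the supersingular prime `p = 3`, `a_3 = 0`; needs the newform of `E₁`, i.e. it is
    a negative lemma MODULO modularity: `crux_false_without_ordinary_of_modularity`). So the natural
    strengthening "at every prime of GOOD reduction" is false AS TYPED (junk `α = 0`), not merely
    unknown — planners must not weaken `IsOrdinaryAt` to `HasGoodReductionAtPrime`.
  - `[W.IsGloballyMinimal]`, `[W.IsElliptic]`, `[Fact p.Prime]`, `[NeZero N]` are typing
    prerequisites of `frobeniusTrace` / `Gamma0`, not droppable.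
* §3 WHAT ANY PROOF MUST DELIVER (consequences = lower bounds on difficulty, kernel-checked):
  - `rank_eq_zero_iff_analyticRank_eq_zero_of_crux`: S ⇒ at every good ordinary `(E,p,f)`,
    `rank E(ℚ) = 0 ↔ ord_{s=1} L(E,s) = 0`; globally (one ordinary `p ≥ 5` per curve exists, PROVED)
    `bsdRank_rankZero_cases_of_crux`: S ∧ modularity ⇒ `∀ E/ℚ, rank = 0 ↔ r_an = 0` — the `→`
    half is the OPEN rank-zero converse of Kolyvagin. So S is at least that hard, with no help
    from crux #2.
  - `even_rank_iff_even_analyticRank_of_crux` / `mordellWeilParity_of_crux`: S ∧ modularity ⇒ the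
    Mordell–Weil PARITY CONJECTURE `rank E(ℚ) ≡ ord_{s=1} L(E,s) (mod 2)` for every `E/ℚ` (via the
    PROVED `p`-adic functional-equation parity at an odd ordinary prime of conductor level). Open in
    print (known for Selmer coranks only: Dokchitser–Dokchitser). So S ⊇ MW-parity.
* §4 LINE `Sketch` (lead prover-line-…-0490-0; 7 stubs): every stub carries `IsNewformOf W f`, so
  no stub admits an in-Lean counter-instance (no constructible newform); `levelZero` LANDED
  (p97204); `noExcessOne` / `knownCases`(a) are closable from the proved parity theorem
  `even_order_padicLFunction_iff_even_analyticRank_conductorLevel`; the OPEN residues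
  `noExcessHigh` (IMC at `T` + `T`-semisimplicity), `shaSide` (`Ш[p^∞]` finite), `residueTwo`
  (`p = 2`) are exactly MTT's conjecture split along Kato's chain — no cheaper target exists.
  Joint sufficiency `pAdicOrderPadicBSDrankR2_of` is kernel-checked in the skeleton: no gap.
* §5 WHY IT RESISTS (for the provers): (i) the LHS is the `T`-order of a power series whose
  coefficients are `limUnder`s of Riemann sums — inside Lean it is reachable only through the proved
  closed forms (constant term = `(1-α⁻¹)²[0]⁺`, parity of the order), and S passes both consistency
  checks (§3 are believed-true statements); (ii) the hypotheses need a `CuspForm` term with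
  `IsNewformOf` — a modularity instance, not constructible — so every refutation is at best modulo
  `exists_isNewformOf`; (iii) numerically, at an ODD good ordinary `p` no finite computation can
  refute S: `ord < rank` contradicts Kato's theorem `rank ≤ corank Sel ≤ ord_T L_p`, and `ord > rank`
  requires certifying exact vanishing of `p`-adic numbers; the ONLY falsification window is `p = 2`
  (no Kato/IMC), where a certified `ord_T L_2(E,T) < rank` would kill S as typed (class misstated,
  repair `5 ≤ p →`): probed by kit job j016625 (PARI 2.15 `ellpadicbsd`, a₂-odd rank-≥2 curves,
  N ≤ 3000) — see `-- p = 2 probe` below for the outcome.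
  OUTCOME (jobs j016625, j017455, j017673, j017809; evidence `compute-j0….json` on the item): PARI's
  `p = 2` machinery validated on rank-0/1 controls; 63 rank-2 curves (odd `N ≤ 4000`, `a₂` odd, root
  number `+1`, box `|a₄| ≤ 80, |a₆| ≤ 150`): **62 certified `r₂ = 2 = rank` (consistent), 0 anomalies
  (`r₂ < rank`), 0 certified excess**; ONE curve, `N = 2813 = 29·97`, `[1,1,0,4,1]` — the only
  ANOMALOUS one of the sample (`a₂ = +1`, `#Ẽ(𝔽₂) = 2`) — has ALL `s`-derivatives `k ≤ 4` of
  `L_2(E, ⟨·⟩^s)` at `s = 0` vanishing to `O(2^20…2^31)` at working precision `2^34`, while every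
  `a₂ = -1` curve shows `v₂(L₂'') ∈ [5, 16]`. RESOLVED by the control job j018098 (§6): it is a PARI
  ARTEFACT — for EVERY curve with `a₂ = +1` (unit root `α ≡ 1 mod 2`), PARI 2.15.4 returns a
  2-adic `L`-function vanishing identically to working precision, even for RANK-0 curves
  (`N = 205, 89, 307`, `L(E,1)/Ω = 1, 1/2, 1`) whose constant term is `(1-α⁻¹)² L(E,1)/Ω⁺ ≠ 0` of
  valuation `≤ 3` by the PROVED interpolation theorem (`constantCoeff_padicLFunction_unitRoot`); both
  code paths (`mspadicL` and `ellpadicL`) agree on the bogus zero, while all `a₂ = -1` controls are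
  exact (rank 0: `2³u`; rank 1: constant `O(2^39)`, first derivative `2³u`). So: NO evidence against
  S at `p = 2`; the anomalous sub-case `a₂ = +1` is simply NOT TESTABLE with this tool (recorded as a
  tool limitation for every seat: do not trust PARI 2.15 `ellpadicL`/`mspadic*` at `p = 2`, `a₂ = +1`).
* LANDED from this file (Theorems/PAdicOrderPadicBSDrankR2/Negative/): `FalseWithoutNewform` (p99210,
  accepted), `ConsequencesOfCrux` (p102285, accepted), `FalseWithoutOrdinary` (p103965; reuses the
  sibling `PAdicOrderThesisR2/Negative/AtEveryGoodPrimeFalse` of the 0487 disprover), `ShaCotorsionOfCrux`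
  (p106027) — all four ACCEPTED.
* NEAR-MISSES: none claimable as `¬S`.
-/

-- D-0017: single-problem summit, so `Summit.BirchSwinnertonDyer.BirchSwinnertonDyer.…` repeats a
-- namespace BY DESIGN.
set_option linter.dupNamespace false

noncomputable section

namespace Summit.BirchSwinnertonDyer.BirchSwinnertonDyer.Cruxes.PAdicOrderPadicBSDrankR2.Disproof

open scoped MatrixGroups ModularForm
open Filter Topology
open CongruenceSubgroup Literature.NumberTheory.EllipticCurves
  Literature.NumberTheory.EllipticCurves.ModularForms
open Summit.BirchSwinnertonDyer.BirchSwinnertonDyer.Theses.PAdicOrderV2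

/-! ## §1 Junk values of the `p`-adic `L`-function -/

section JunkRoot

variable {N : ℕ} (f : CuspForm (Gamma0 N) 2) {p : ℕ} [Fact p.Prime]

/-- At the junk root `α = 0` the Mazur–Swinnerton-Dyer measure vanishes at every positive level
(`0⁻¹ = 0`, `0^{n+1} = 0`). [folklore] -/
theorem msdMeasure_zero_root_succ (n : ℕ) (a : ZMod (p ^ (n + 1))) :
    msdMeasure f (0 : ℚ_[p]) (n + 1) a = 0 := by
  simp [msdMeasure]

/-- Same, for any level `m ≥ 1`. [folklore] -/
theorem msdMeasure_zero_root_of_pos {m : ℕ} (hm : 0 < m) (a : ZMod (p ^ m)) :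
    msdMeasure f (0 : ℚ_[p]) m a = 0 := by
  obtain ⟨n, rfl⟩ := Nat.exists_eq_succ_of_ne_zero hm.ne'
  exact msdMeasure_zero_root_succ f n a

omit [Fact p.Prime] in
/-- The cyclotomic exponent `e₀` is positive (`1`, or `2` at `p = 2`). [folklore] -/
theorem cyclotomicExponent_pos : 0 < cyclotomicExponent p := by
  unfold cyclotomicExponent; split_ifs <;> omega

/-- Every Riemann sum of `L_p(f, 0, T)` vanishes (they live at levels `n + e₀ ≥ 1`). [folklore] -/
theorem padicLRiemannSum_zero_root (k n : ℕ) : padicLRiemannSum f (0 : ℚ_[p]) k n = 0 := by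
  unfold padicLRiemannSum
  have hpos : 0 < n + cyclotomicExponent p := Nat.add_pos_right _ cyclotomicExponent_pos
  simp [msdMeasure_zero_root_of_pos f hpos]

/-- Every coefficient of `L_p(f, 0, T)` vanishes (limit of the zero sequence). [folklore] -/
theorem padicLCoeff_zero_root (k : ℕ) : padicLCoeff f (0 : ℚ_[p]) k = 0 := by
  unfold padicLCoeff
  have h : padicLRiemannSum f (0 : ℚ_[p]) k = fun _ ↦ 0 := funext (padicLRiemannSum_zero_root f k)
  rw [h]
  exact tendsto_const_nhds.limUnder_eq

/-- **Junk root:** `L_p(f, 0, T) = 0` in `ℚ_p⟦T⟧` for every cusp form `f`. [folklore] -/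
theorem padicLFunction_zero_root : padicLFunction f (0 : ℚ_[p]) = 0 := by
  ext k
  simp [padicLCoeff_zero_root]

/-- Hence `ord_T L_p(f, 0, T) = ⊤`, never a natural number. [folklore] -/
theorem order_padicLFunction_zero_root_ne_natCast (r : ℕ) :
    (padicLFunction f (0 : ℚ_[p])).order ≠ (r : ℕ∞) := by
  rw [padicLFunction_zero_root, PowerSeries.order_zero]
  exact ENat.top_ne_coe r

end JunkRoot

section JunkForm

variable {N : ℕ} {p : ℕ} [Fact p.Prime]

/-- The modular symbols of the zero cusp form vanish. [folklore] -/
theorem modularSymbol_zero_form (r : ℚ) : modularSymbol (0 : CuspForm (Gamma0 N) 2) r = 0 := by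
  simp [modularSymbol]

/-- The normalised plus symbol of the zero form vanishes (whatever the junk period is: `0 / x = 0`).
[folklore] -/
theorem normalizedPlusSymbol_zero_form (r : ℚ) :
    normalizedPlusSymbol (0 : CuspForm (Gamma0 N) 2) r = 0 := by
  simp [normalizedPlusSymbol, plusSymbol, modularSymbol_zero_form]

/-- The rational plus symbol of the zero form vanishes. [folklore] -/
theorem ratPlusSymbol_zero_form (r : ℚ) : ratPlusSymbol (0 : CuspForm (Gamma0 N) 2) r = 0 := by
  have hex : ∃ q : ℚ, (q : ℝ) = normalizedPlusSymbol (0 : CuspForm (Gamma0 N) 2) r :=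
    ⟨0, by rw [normalizedPlusSymbol_zero_form, Rat.cast_zero]⟩
  rw [ratPlusSymbol, dif_pos hex]
  exact_mod_cast (hex.choose_spec.trans (normalizedPlusSymbol_zero_form r) :
    ((hex.choose : ℚ) : ℝ) = 0)

/-- The MSD measure of the zero form vanishes identically. [folklore] -/
theorem msdMeasure_zero_form (α : ℚ_[p]) (n : ℕ) (a : ZMod (p ^ n)) :
    msdMeasure (0 : CuspForm (Gamma0 N) 2) α n a = 0 := by
  cases n with
  | zero => simp [msdMeasure, ratPlusSymbol_zero_form]
  | succ n => simp [msdMeasure, ratPlusSymbol_zero_form]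

/-- **Junk form:** `L_p(0, α, T) = 0` for every `α`. [folklore] -/
theorem padicLFunction_zero_form (α : ℚ_[p]) : padicLFunction (0 : CuspForm (Gamma0 N) 2) α = 0 := by
  ext k
  simp only [coeff_padicLFunction, map_zero]
  unfold padicLCoeff
  have h : padicLRiemannSum (0 : CuspForm (Gamma0 N) 2) α k = fun _ ↦ 0 := by
    funext n
    unfold padicLRiemannSum
    simp [msdMeasure_zero_form]
  rw [h]
  exact tendsto_const_nhds.limUnder_eq

end JunkForm

section UnitRoot

variable (W : WeierstrassCurve ℚ) [W.IsGloballyMinimal] (p : ℕ) [Fact p.Prime]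

/-- **Off the ordinary locus the tree's unit root is the junk `0`**: if `p ∣ a_p(W)` (e.g. `p` a good
supersingular prime, or `p = 2, 3` with `a_p ≡ 0`), then `X² - a_p X + p` has no unit root in `ℤ_p`
(a unit root `α` would give `α² = a_p α - p ∈ pℤ_p`), so `unitRoot W p = 0` by its `dite`.
[folklore] -/
theorem unitRoot_eq_zero_of_dvd_frobeniusTrace (h : (p : ℤ) ∣ W.frobeniusTrace p) :
    unitRoot W p = 0 := by
  unfold unitRoot
  rw [dif_neg]
  rintro ⟨α, ⟨hα, hu⟩, -⟩
  have hnorm_a : ‖((W.frobeniusTrace p : ℤ) : ℤ_[p])‖ < 1 :=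
    (PadicInt.norm_int_lt_one_iff_dvd _).2 h
  have h1 : ‖α‖ = 1 := PadicInt.isUnit_iff.mp hu
  have hsq : α ^ 2 = ((W.frobeniusTrace p : ℤ) : ℤ_[p]) * α + -(p : ℤ_[p]) := by
    linear_combination hα
  have hlt : ‖α ^ 2‖ < 1 := by
    rw [hsq]
    refine lt_of_le_of_lt (PadicInt.nonarchimedean _ _) (max_lt ?_ ?_)
    · rw [norm_mul, h1, mul_one]; exact hnorm_a
    · rw [norm_neg, PadicInt.norm_p]
      exact inv_lt_one_of_one_lt₀ (by exact_mod_cast (Fact.out : p.Prime).one_lt)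
  rw [norm_pow, h1, one_pow] at hlt
  exact lt_irrefl _ hlt

end UnitRoot

/-! ## §2 Load-bearing hypotheses -/

section LoadBearing

/-- The crux with the hypothesis `IsNewformOf W f` DROPPED (any cusp form of any level). -/
def WithoutNewform : Prop :=
  ∀ (W : WeierstrassCurve ℚ) [W.IsElliptic] [W.IsGloballyMinimal] (p : ℕ) [Fact p.Prime],
    IsOrdinaryAt W p → ∀ {N : ℕ} [NeZero N] (f : CuspForm (Gamma0 N) 2),
      (padicLFunction f (unitRoot W p : ℚ_[p])).order = W.mordellWeilRank

/-- The crux with ordinarity WEAKENED to good reduction (`IsOrdinaryAt W p` ↦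
`W.HasGoodReductionAtPrime p`): the natural strengthening "BSD(`p`) rank clause at every good
prime". -/
def WithoutOrdinary : Prop :=
  ∀ (W : WeierstrassCurve ℚ) [W.IsElliptic] [W.IsGloballyMinimal] (p : ℕ) [Fact p.Prime],
    W.HasGoodReductionAtPrime p → ∀ {N : ℕ} [NeZero N] (f : CuspForm (Gamma0 N) 2),
      IsNewformOf W f → (padicLFunction f (unitRoot W p : ℚ_[p])).order = W.mordellWeilRank

/-- The congruent number curve `E₁ : y² = x³ - x` (Cremona 32a2) is elliptic. [folklore] -/
instance isElliptic_E1 : (congruentNumberCurve 1).IsElliptic := isElliptic_congruentNumberCurve one_ne_zero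

/-- `y² = x³ - x` is a global minimal model (`Δ = 64`). [folklore] -/
instance isGloballyMinimal_E1 : (congruentNumberCurve 1).IsGloballyMinimal :=
  isGloballyMinimal_congruentNumberCurve squarefree_one

/-- **`IsNewformOf` is load-bearing (unconditionally):** the zero form has `L_p(0, α, T) = 0`, of
order `⊤ ≠ rank`; witness `E₁ : y² = x³ - x` at any of its good ordinary primes (one `≥ 5` exists
by the tree theorem `exists_good_ordinary_prime_holds`). [folklore] -/
theorem crux_false_without_newform : ¬ WithoutNewform := by
  intro h
  obtain ⟨p, hp, -, hgood, hord⟩ :=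
    WeierstrassCurve.exists_good_ordinary_prime_holds (congruentNumberCurve 1)
  haveI : NeZero (1 : ℕ) := ⟨one_ne_zero⟩
  have h1 := h (congruentNumberCurve 1) p ⟨hgood, hord⟩ (N := 1) (0 : CuspForm (Gamma0 1) 2)
  rw [padicLFunction_zero_form, PowerSeries.order_zero] at h1
  exact ENat.top_ne_coe _ h1

/-- `3` is a prime of good SUPERSINGULAR reduction of `E₁ : y² = x³ - x`: good reduction
(`3 ∤ 2·1`) and `a_3(E₁) = 0` (Ireland–Rosen Thm 18.5, `p ≡ 3 (mod 4)`), in the tree's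
`frobeniusTrace` of the global minimal model. [folklore] -/
theorem E1_good_supersingular_three :
    haveI : Fact (Nat.Prime 3) := ⟨Nat.prime_three⟩
    (congruentNumberCurve 1).HasGoodReductionAtPrime 3 ∧ (congruentNumberCurve 1).frobeniusTrace 3 = 0 := by
  haveI : Fact (Nat.Prime 3) := ⟨Nat.prime_three⟩
  refine ⟨hasGoodReductionAtPrime_congruentNumberCurve (n := 1) (p := 3) (by decide), ?_⟩
  rw [frobeniusTrace_congruentNumberCurve]
  exact frobeniusTrace_congruentNumberCurveInt Nat.prime_three rfl (by decide)

/-- **Ordinarity is load-bearing, modulo the newform of `E₁`:** given ANY `f` with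
`IsNewformOf E₁ f` (the CM newform of level `32`), the good-reduction strengthening
`WithoutOrdinary` fails at `(E₁, p = 3, f)`: `3` is supersingular for `E₁`, so the tree's
`unitRoot E₁ 3` is the junk `0` and `L_3(f, 0, T) = 0` has order `⊤ ≠ rank`. [folklore] -/
theorem crux_false_without_ordinary_of_isNewformOf {N : ℕ} [NeZero N] (f : CuspForm (Gamma0 N) 2)
    (hf : IsNewformOf (congruentNumberCurve 1) f) : ¬ WithoutOrdinary := by
  intro h
  haveI : Fact (Nat.Prime 3) := ⟨Nat.prime_three⟩
  obtain ⟨hgood, htr⟩ := E1_good_supersingular_three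
  have hα : unitRoot (congruentNumberCurve 1) 3 = 0 :=
    unitRoot_eq_zero_of_dvd_frobeniusTrace _ _ (by rw [htr]; exact dvd_zero _)
  have h1 := h (congruentNumberCurve 1) 3 hgood f hf
  rw [hα, PadicInt.coe_zero, padicLFunction_zero_root, PowerSeries.order_zero] at h1
  exact ENat.top_ne_coe _ h1

/-- The same, modulo the modularity fact `exists_isNewformOf` of the tree (Breuil–Conrad–Diamond–
Taylor; Diamond–Shurman Thm 8.8.3), which supplies the newform of `E₁` at level `N_{E₁}`
(`NeZero` by `conductorNorm_pos_holds`). NEGATIVE LEMMA MODULO H with `H = exists_isNewformOf`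
(an existing named fact, not constructible in the tree today). [folklore] -/
theorem crux_false_without_ordinary_of_modularity (hmod : exists_isNewformOf) : ¬ WithoutOrdinary := by
  haveI : NeZero ((congruentNumberCurve 1).conductorNorm ℤ) :=
    ⟨(WeierstrassCurve.conductorNorm_pos_holds (W := congruentNumberCurve 1)).ne'⟩
  obtain ⟨f, hf⟩ := hmod (congruentNumberCurve 1)
  exact crux_false_without_ordinary_of_isNewformOf f hf

end LoadBearing

/-! ## §3 What any proof of the crux must deliver -/

section Consequences

variable (hS : PAdicOrderPadicBSDrankR2)
include hS

/-- **S decides rank zero against analytic rank zero at every good ordinary point.** From the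
proved level-zero theorem `ord_T L_p = 0 ↔ r_an = 0` (interpolation, `α ≠ 1`, `Ω⁺_f > 0`;
`order_padicLFunction_eq_zero_iff_analyticRank_eq_zero`): under S, `rank E(ℚ) = 0 ↔ r_an(E) = 0`.
The `→` direction is the OPEN rank-zero converse to Kolyvagin. [folklore] -/
theorem rank_eq_zero_iff_analyticRank_eq_zero_of_crux (W : WeierstrassCurve ℚ) [W.IsElliptic]
    [W.IsGloballyMinimal] (p : ℕ) [Fact p.Prime] (hord : IsOrdinaryAt W p) {N : ℕ} [NeZero N]
    (f : CuspForm (Gamma0 N) 2) (hf : IsNewformOf W f) :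
    W.mordellWeilRank = 0 ↔ W.analyticRank = 0 := by
  rw [← Cruxes.PAdicOrderThesisR2.KatoSandwich.order_padicLFunction_eq_zero_iff_analyticRank_eq_zero
    W p hord hf, hS W p hord f hf]
  exact_mod_cast Iff.rfl

/-- **S forces Mordell–Weil parity at every odd good ordinary point of conductor level**: with the
PROVED `p`-adic parity `ord_T L_p ≡ r_an (mod 2)` (`p` odd, `f` of level `N_W`;
`even_order_padicLFunction_iff_even_analyticRank_conductorLevel`, Greenberg LNM 1716 §5), S gives
`rank E(ℚ) ≡ r_an(E) (mod 2)`. [folklore] -/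
theorem even_rank_iff_even_analyticRank_of_crux (W : WeierstrassCurve ℚ) [W.IsElliptic]
    [W.IsGloballyMinimal] (p : ℕ) [Fact p.Prime] (hp : p ≠ 2) (hord : IsOrdinaryAt W p)
    (f : CuspForm (Gamma0 (W.conductorNorm ℤ)) 2) [NeZero (W.conductorNorm ℤ)] (hf : IsNewformOf W f) :
    Even W.mordellWeilRank ↔ Even W.analyticRank := by
  rw [← Literature.Barriers.BirchSwinnertonDyer.even_order_padicLFunction_iff_even_analyticRank_conductorLevel
    hp hord hf, hS W p hord f hf]
  simp

omit hS in
/-- Bookkeeping: every elliptic globally minimal `W/ℚ` has an ODD good ordinary prime (indeed one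
`≥ 5`, tree theorem `exists_good_ordinary_prime_holds`). [folklore] -/
theorem exists_odd_ordinary (W : WeierstrassCurve ℚ) [W.IsElliptic] [W.IsGloballyMinimal] :
    ∃ (p : ℕ) (_ : Fact p.Prime), p ≠ 2 ∧ IsOrdinaryAt W p := by
  obtain ⟨p, hp, h5, hgood, hord⟩ := WeierstrassCurve.exists_good_ordinary_prime_holds W
  exact ⟨p, hp, by omega, hgood, hord⟩

/-- **Global form, modulo modularity: S ⇒ the rank part of BSD on `{rank = 0} ∪ {r_an = 0}`.**
For every elliptic globally minimal `W/ℚ`: `rank = 0 ↔ r_an = 0` (one good ordinary prime per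
curve, PROVED to exist; the newform from `exists_isNewformOf`). [folklore] -/
theorem bsdRank_rankZero_cases_of_crux (hmod : exists_isNewformOf) (W : WeierstrassCurve ℚ)
    [W.IsElliptic] [W.IsGloballyMinimal] : W.mordellWeilRank = 0 ↔ W.analyticRank = 0 := by
  haveI : NeZero (W.conductorNorm ℤ) := ⟨(WeierstrassCurve.conductorNorm_pos_holds (W := W)).ne'⟩
  obtain ⟨f, hf⟩ := hmod W
  obtain ⟨p, hp, -, hord⟩ := exists_odd_ordinary W
  exact rank_eq_zero_iff_analyticRank_eq_zero_of_crux hS W p hord f hf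

/-- **Global form, modulo modularity: S ⇒ the Mordell–Weil parity conjecture** `rank E(ℚ) ≡
ord_{s=1} L(E,s) (mod 2)` for every elliptic globally minimal `W/ℚ` (hence every `E/ℚ`). Open in
print; known for `p^∞`-Selmer coranks (Dokchitser–Dokchitser 2010). [folklore] -/
theorem mordellWeilParity_of_crux (hmod : exists_isNewformOf) (W : WeierstrassCurve ℚ)
    [W.IsElliptic] [W.IsGloballyMinimal] : Even W.mordellWeilRank ↔ Even W.analyticRank := by
  haveI : NeZero (W.conductorNorm ℤ) := ⟨(WeierstrassCurve.conductorNorm_pos_holds (W := W)).ne'⟩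
  obtain ⟨f, hf⟩ := hmod W
  obtain ⟨p, hp, hp2, hord⟩ := exists_odd_ordinary W
  exact even_rank_iff_even_analyticRank_of_crux hS W p hp2 hord f hf

/-- **§3b. `S` + Kato's bound ⇒ `corank Sel_{p^∞}(E/ℚ) = rank E(ℚ)`** at a good ordinary point:
Kato gives `corank ≤ ord = rank` (the equality is `S`), Kummer `rank ≤ corank` (PROVED corank
identity `selmerCorank_eq_mordellWeilRank_add_holds`). [folklore] -/
theorem selmerCorank_eq_rank_of_crux (W : WeierstrassCurve ℚ) [W.IsElliptic] [W.IsGloballyMinimal]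
    (p : ℕ) [Fact p.Prime] (hord : IsOrdinaryAt W p) {N : ℕ} [NeZero N] {f : CuspForm (Gamma0 N) 2}
    (hf : IsNewformOf W f)
    (hkato : (W.selmerCorank p : ℕ∞) ≤ (padicLFunction f (unitRoot W p : ℚ_[p])).order) :
    W.selmerCorank p = W.mordellWeilRank := by
  rw [hS W p hord f hf] at hkato
  have h1 : W.selmerCorank p ≤ W.mordellWeilRank := by exact_mod_cast hkato
  have h2 := W.selmerCorank_eq_mordellWeilRank_add_holds p
  omega

/-- **`S` + Kato's bound ⇒ `corank_{ℤ_p} Ш(E/ℚ)[p^∞] = 0`** at every good ordinary point where Kato's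
inequality is available (named fact `kato_selmerCorank_le_order_padicLFunction`, `p` odd): any proof
of `S` proves the `Ш`-cotorsion leg prime by prime. [folklore] -/
theorem shaCorank_eq_zero_of_crux (W : WeierstrassCurve ℚ) [W.IsElliptic] [W.IsGloballyMinimal]
    (p : ℕ) [Fact p.Prime] (hord : IsOrdinaryAt W p) {N : ℕ} [NeZero N] {f : CuspForm (Gamma0 N) 2}
    (hf : IsNewformOf W f)
    (hkato : (W.selmerCorank p : ℕ∞) ≤ (padicLFunction f (unitRoot W p : ℚ_[p])).order) :
    W.shaCorank p = 0 := by
  have h1 := selmerCorank_eq_rank_of_crux hS W p hord hf hkato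
  have h2 := W.selmerCorank_eq_mordellWeilRank_add_holds p
  omega

/-- The same fed with Kato's theorem in its tree form (odd `p`). [folklore] -/
theorem shaCorank_eq_zero_of_crux_of_kato (W : WeierstrassCurve ℚ) [W.IsElliptic]
    [W.IsGloballyMinimal] (p : ℕ) [Fact p.Prime] (hp : p ≠ 2) (hord : IsOrdinaryAt W p) {N : ℕ}
    [NeZero N] {f : CuspForm (Gamma0 N) 2} (hf : IsNewformOf W f)
    (hK : kato_selmerCorank_le_order_padicLFunction W p (f := f)) : W.shaCorank p = 0 :=
  shaCorank_eq_zero_of_crux hS W p hord hf (hK hp hord hf)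

end Consequences

/-! ## §4 Line `Sketch` (lead skeleton `Lines/Sketch.lean`, 7 stubs) — Targets

No stub is attackable by an in-Lean instance: each quantifies over `f` with `IsNewformOf W f`.
* `stub_padicBSDrank_facts` — bundle of four printed theorems (Kato 18.4, Kato 14.3/Kolyvagin,
  Dokchitser–Dokchitser `p`-parity, Carayol); BLOCKED on facts, consistent.
* `stub_padicBSDrank_levelZero` — LANDED by the lead (p97204, `Theorems/PAdicOrderV2PadicBSDrankLevelZero`).
* `stub_padicBSDrank_noExcessOne`, `stub_padicBSDrank_knownCases` (a) — closable from the proved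
  `even_order_padicLFunction_iff_even_analyticRank_conductorLevel` (+ Carayol hypothesis `N = N_W`
  to move `f` to conductor level: rewrite `N`, then the theorem applies verbatim).
* OPEN residues `noExcessHigh` (`p` odd, `ord ≥ 2 ⇒ ord ≤ corank`), `shaSide`
  (`1 ≤ ord = corank ⇒ corank ≤ rank`), `residueTwo` (`p = 2`, `ord ≥ 1`): these ARE MTT's
  conjecture cut along `rank ≤ corank ≤ ord`; mutation check on paper: dropping `p ≠ 2` from
  `noExcessHigh`/`shaSide` changes nothing provable; dropping `1 ≤ ord` from `shaSide` makes it the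
  full `Ш[p^∞]`-cotorsion statement (still open, still consistent); `residueTwo` without `1 ≤ ord`
  is the whole crux at `p = 2` (its level-zero part is proved). No stub is refutable here; none is
  mis-stated (signatures re-read against `Lines/Sketch.lean`).

-/

/-! ## §6 The `p = 2` probe (the unique falsification window) — data

Pipeline (PARI/GP 2.15.4, `kit compute`, evidence files `compute-<job>.json` on the item):
`msfromell(E,1)` → `mspadicinit(M, 2, n, 0)` → `mspadicmoments` → `mspadicL(mu, 0, k)`, the `k`-th
`s`-derivative at `s = 0` of `L_2(E, ⟨·⟩^s)` (same `T`-order as `L_2(E,T)`, `T = 5^s - 1`);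
`r₂ :=` least `k` with a derivative PROVABLY non-zero mod `2^n` = a certified upper bound of
`ord_T L_2(E,T)`; "consistent" means `r₂ = rank` (lower derivatives `O(2^n)`).

* j016625 (`ellpadicbsd`, self-adjusting precision): rank-0/1 controls with `a₂ = -1` give `r₂ = 0`,
  resp. `1` as expected (PR-type non-degeneracy at `p = 2` in 4/4 rank-1 cases); every `a₂ = +1`
  control made `ellpadicbsd` escalate precision until the 3.8 GB stack overflowed (first hint).
* j017455 (fixed `n = 6`): 45 rank-2 candidates, all inconclusive (precision too low: derivative
  `k` costs about `2k + v₂(k!)` bits through `(log_2 5)^k k!`).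
* j017673 (`n = 18`; odd `N ≤ 4000`, `|a₄| ≤ 80`, `|a₆| ≤ 150`): 63 rank-2 curves (all with
  `rank_lo = rank_hi = 2` by `ellrank`, `r_an = 2`): 59 consistent, 4 inconclusive, 0 anomalies.
* j017809 (`n = 34` on the 4): `N = 2563, 2619, 3573` consistent (`v₂(L₂'') = 12, 12, 16`);
  `N = 2813` `[1,1,0,4,1]` (`a₂ = +1`, the only anomalous curve of the sample): derivatives
  `k = 0..4` are `O(2^31), O(2^27), O(2^24), O(2^22), O(2^20)` — total vanishing to precision.
* j017835: no data (GP syntax error: a multi-line vector literal outside braces). j018098 (its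
  fixed re-run; `a₂ = +1` controls of rank 0/1 at `n = 40`, both code paths): rank-0 `a₂ = +1` controls
  `N = 205` `[1,1,0,-2,-1]`, `N = 89` `[1,1,0,-1,0]`, `N = 307` `[1,1,0,0,-1]` with
  `L(E,1)/Ω = 1, 1/2, 1`: constant term `O(2^37..38)` from `mspadicL` AND `O(2^10)` from
  `ellpadicL(E,2,12)` — impossible for the true `L_2(E,0) = (1-α⁻¹)² L(E,1)/Ω⁺ ≠ 0` (valuation `≤ 3`);
  rank-1 `a₂ = +1` controls (`N = 249, 575`) likewise all `O(2^27+)`; the target `N = 2813` the same.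
  `a₂ = -1` sanity controls exact: `N = 113` (rank 0): `2³u, 2⁶u, 2⁶u, 2⁹u`; `N = 89` `[1,1,1,-1,0]`
  (rank 1): `O(2^39), 2³u, 2⁶u, 2¹¹u`. VERDICT: PARI 2.15.4's 2-adic `L`-function is identically
  (bogus) zero whenever `a₂ = +1`; the `N = 2813` signal is that artefact, not an excess zero.

Reading: no certified violation of the crux at `p = 2` in 62 conclusive rank-2 cases (all `a₂ = -1`);
the anomalous sub-case `a₂ = +1` (`α ≡ 1 mod 2`) is untestable with PARI 2.15 and remains the one
numerically unexplored corner of the `p = 2` window (a Sage/Magma `padic_lseries` or a direct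
Riemann-sum evaluation of the tree's own `msdMeasure` from modular symbols would cover it).
-/

end Summit.BirchSwinnertonDyer.BirchSwinnertonDyer.Cruxes.PAdicOrderPadicBSDrankR2.Disproof

end
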